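import Summits.ResolutionOfSingularities.ResolutionOfSingularities.Theorems.PurelyInseparableDim4ResConeCornerWalls
import HarnessLib
import HarnessLib.Audit.Tags

/-!
# Purely inseparable four-folds — the LEVEL-1 AXES of the polygon under pure corners: the slot `x_a²·y^{d−1}`
# that decides rigidity is fed only by the `x_a`-axis, which marches down one step per `a`-corner and is
# emptied by every `a′`-corner (K2(p) lane, SLICE C (C7b), file-holder res-dim4-p-5 g3)

[OURS · counted 0 · cell `res-dim4-pi` · K2(p) lane (desk WORDS #78 (d), #80 (d)) · seat res-dim4-p-5 g3.]
Nothing here proves K2(p), `NoIsolatedTrap p p` or resolution of singularities in dimension ≥ 4 /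
characteristic `p`.

Setting (`…ResConeCornerTransport` / `…CornerWalls`): pure corner `s′ = step q univ j 0 s`, `x^r ∣ F`, `q ≤ ord₀ F = o`, residual
degree `d = o − |r|`, two active letters `a ≠ a′`, passive exponents `ν` (`ν_a = ν_{a′} = 0`).  The LEVEL-1
`x_a`-AXIS SLOT `i` of a state is the set of monomials `x^r · x_a^i · y^ν` of `F` with `ν` passive of degree
`d − 1` (the points `(i, 0)` of level `1` of Hironaka's polygon `Δ(G; x_a, x_{a′}; y)`); «slot `i` empty» is the
def-free clause `∀ ν, ν a = 0 → ν a′ = 0 → ν.degree + 1 = d → coeff (r + ν + i·e_a) F = 0`.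

* **`axisSlot_step_zero_same`** — after a pure corner in chart `a`, slot `i` of the child is empty as soon as
  slot `i + 1` of the parent is (the axis marches down: `T_a (i+1, 0) = (i, 0)`, no births);
* **`axisSlot_step_zero_other`** — after a pure corner in chart `a′`, every slot `i ≥ 2` of the child's
  `x_a`-axis is empty, whatever the parent (`T_{a′} (i, 0) = (i, i − 1)` leaves the axis);
hence along a pure-corner word in `{a, a′}` the slots `i ≥ 2` of both axes, once empty, stay empty
(`…ResConeCornerRigidTail`, (C7c)). [cite: CossartJannsenSaito2020, Lemma 13.2, Lemma 13.4]
bears_on: LADDER-RESOLUTION:D157-DOOR2 (res-dim4-pi · K2(p) = `RidgeBudget.NoAboveFloorTrap p p` · slice C).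
Supports stmt-ResolutionOfSingularities-16155 (helper).
-/

set_option linter.dupNamespace false -- mandated namespace of this single-conjunct summit

noncomputable section

namespace Summit.ResolutionOfSingularities.ResolutionOfSingularities.Theorems.PIDim4

namespace ResCone

open MvPolynomial Finset
open Literature.AlgebraicGeometry.Resolution
open Literature.AlgebraicGeometry.Resolution.CentreBlowup
open Literature.AlgebraicGeometry.Resolution.Hauser2010
open Literature.AlgebraicGeometry.Resolution.HauserPerlega2019

variable {K : Type} [Field K]

section Axis

variable [DecidableEq K]

/-- The residual exponent of the SOURCE of an axis monomial of the child: if `x^{r′ + ν + i·e_a}` (`ν` passive) is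
a monomial of the child of the pure corner in chart `j`, its source `x^e` in `F` has residual exponent
`f = e − r` with `f.update j (|f| − d) = ν + i·e_a`. [cite: CossartJannsenSaito2020, Lemma 13.2] -/
theorem exists_source_of_axis_mem (q : ℕ) (j a : Fin 4) (s : State K) {o : ℕ} (ho : ordZero s.F = o)
    (hr : ∀ d ∈ s.F.support, s.r ≤ d) (hqo : q ≤ o) {ν : Fin 4 →₀ ℕ} {i : ℕ}
    (hmem : (CentreBlowup.step q Finset.univ j 0 s).r + ν + Finsupp.single a i ∈
      (CentreBlowup.step q Finset.univ j 0 s).F.support) :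
    ∃ e ∈ s.F.support, (e - s.r).update j ((e - s.r).degree - (o - s.r.degree)) = ν + Finsupp.single a i := by
  have hq : (q : ℕ∞) ≤ ordAlong Finset.univ s.F := by
    rw [ordAlong_univ, ho]; exact_mod_cast hqo
  obtain ⟨e, he, heE⟩ := exists_of_mem_support_step_zero j s hmem
  refine ⟨e, he, ?_⟩
  have h := chartExponent_eq_step_zero_r_add q j s ho hr hqo he
  rw [heE, add_assoc] at h
  exact (add_left_cancel h).symm

/-- **The `x_a`-axis marches down under an `a`-corner**: if the parent has no monomial
`x^r · x_a^{i+1} · y^ν` (`ν` passive of degree `d − 1`), the child of the pure corner in chart `a` has no monomial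
`x^{r′} · x_a^i · y^ν`. [cite: CossartJannsenSaito2020, Lemma 13.2] -/
theorem axisSlot_step_zero_same (q : ℕ) {a a' : Fin 4} (haa : a ≠ a') (s : State K) {o d : ℕ}
    (ho : ordZero s.F = o) (hr : ∀ d ∈ s.F.support, s.r ≤ d) (hqo : q ≤ o) (hd : o - s.r.degree = d) (i : ℕ)
    (hslot : ∀ ν : Fin 4 →₀ ℕ, ν a = 0 → ν a' = 0 → ν.degree + 1 = d →
      coeff (s.r + ν + Finsupp.single a (i + 1)) s.F = 0) :
    ∀ ν : Fin 4 →₀ ℕ, ν a = 0 → ν a' = 0 → ν.degree + 1 = d →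
      coeff ((CentreBlowup.step q Finset.univ a 0 s).r + ν + Finsupp.single a i)
        (CentreBlowup.step q Finset.univ a 0 s).F = 0 := by
  intro ν hνa hνa' hν
  by_contra hne
  obtain ⟨e, he, hf⟩ := exists_source_of_axis_mem q a a s ho hr hqo (MvPolynomial.mem_support_iff.mpr hne)
  set f := e - s.r with hfdef
  have hdeg := le_degree_sub ho hr he
  rw [← hfdef] at hdeg
  -- off the chart letter the source agrees with `ν`; its `a`-exponent is `i + 1`
  have hoff : ∀ k, k ≠ a → f k = ν k := fun k hk => by
    have h := congrArg (fun g : Fin 4 →₀ ℕ => g k) hf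
    simp only [Finsupp.coe_update, Function.update_of_ne hk, Finsupp.coe_add, Pi.add_apply,
      Finsupp.single_eq_of_ne hk, add_zero] at h
    exact h
  have hfa : f.degree - (o - s.r.degree) = i := by
    have h := congrArg (fun g : Fin 4 →₀ ℕ => g a) hf
    simp only [Finsupp.coe_update, Function.update_self, Finsupp.coe_add, Pi.add_apply, hνa,
      Finsupp.single_eq_same, zero_add] at h
    exact h
  have hsplit := degree_eq_apply_add_apply_add_degIn haa f
  have hsplitν := degree_eq_apply_add_apply_add_degIn haa ν
  have hpass : degIn ((Finset.univ.erase a).erase a') f = degIn ((Finset.univ.erase a).erase a') ν := by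
    unfold degIn
    refine Finset.sum_congr rfl fun k hk => hoff k ?_
    rintro rfl
    exact not_mem_passive_left k a' hk
  have hfa' : f a' = 0 := by rw [hoff a' haa.symm, hνa']
  have hfaeq : f a = i + 1 := by omega
  -- so the source is the forbidden parent monomial
  have hfeq : f = ν + Finsupp.single a (i + 1) := by
    ext k
    by_cases hk : k = a
    · rw [hk, Finsupp.add_apply, hνa, Finsupp.single_eq_same, zero_add, hfaeq]
    · rw [Finsupp.add_apply, Finsupp.single_eq_of_ne hk, add_zero, hoff k hk]
  have he' : e = s.r + ν + Finsupp.single a (i + 1) := by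
    rw [add_assoc, ← hfeq, hfdef, add_tsub_cancel_of_le (hr e he)]
  exact (MvPolynomial.mem_support_iff.mp he) (he' ▸ hslot ν hνa hνa' hν)

/-- **An `a′`-corner EMPTIES the `x_a`-axis beyond `(1, 0)`**: the child of the pure corner in chart `a′` has no
monomial `x^{r′} · x_a^i · y^ν` with `i ≥ 2` and `ν` passive of degree `d − 1`, whatever the parent.
[cite: CossartJannsenSaito2020, Lemma 13.4] -/
theorem axisSlot_step_zero_other (q : ℕ) {a a' : Fin 4} (haa : a ≠ a') (s : State K) {o d : ℕ}
    (ho : ordZero s.F = o) (hr : ∀ d ∈ s.F.support, s.r ≤ d) (hqo : q ≤ o) (hd : o - s.r.degree = d) {i : ℕ}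
    (hi : 2 ≤ i) :
    ∀ ν : Fin 4 →₀ ℕ, ν a = 0 → ν a' = 0 → ν.degree + 1 = d →
      coeff ((CentreBlowup.step q Finset.univ a' 0 s).r + ν + Finsupp.single a i)
        (CentreBlowup.step q Finset.univ a' 0 s).F = 0 := by
  intro ν hνa hνa' hν
  by_contra hne
  obtain ⟨e, he, hf⟩ := exists_source_of_axis_mem q a' a s ho hr hqo (MvPolynomial.mem_support_iff.mpr hne)
  set f := e - s.r with hfdef
  have hdeg := le_degree_sub ho hr he
  rw [← hfdef] at hdeg
  have hoff : ∀ k, k ≠ a' → f k = (ν + Finsupp.single a i) k := fun k hk => by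
    have h := congrArg (fun g : Fin 4 →₀ ℕ => g k) hf
    simp only [Finsupp.coe_update, Function.update_of_ne hk] at h
    exact h
  have hfa'' : f.degree - (o - s.r.degree) = 0 := by
    have h := congrArg (fun g : Fin 4 →₀ ℕ => g a') hf
    simp only [Finsupp.coe_update, Function.update_self, Finsupp.coe_add, Pi.add_apply, hνa',
      Finsupp.single_eq_of_ne haa.symm, add_zero] at h
    exact h
  have hfa : f a = i := by
    rw [hoff a haa, Finsupp.add_apply, hνa, Finsupp.single_eq_same, zero_add]
  have hsplit := degree_eq_apply_add_apply_add_degIn haa f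
  have hsplitν := degree_eq_apply_add_apply_add_degIn haa ν
  have hpass : degIn ((Finset.univ.erase a).erase a') f = degIn ((Finset.univ.erase a).erase a') ν := by
    unfold degIn
    refine Finset.sum_congr rfl fun k hk => ?_
    have hka' : k ≠ a' := by rintro rfl; exact not_mem_passive_right a k hk
    have hka : k ≠ a := by rintro rfl; exact not_mem_passive_left k a' hk
    rw [hoff k hka', Finsupp.add_apply, Finsupp.single_eq_of_ne hka, add_zero]
  omega

end Axis

end ResCone

end Summit.ResolutionOfSingularities.ResolutionOfSingularities.Theorems.PIDim4

end
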